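/-
Copyright (c) 2026 the pub-hodgecm-mathlib formalisation cell (harness21).  Prover seat hodgecm-mathlib-B-p14 (g31) (Layer B′ design pen), (F11-c) brick (d2): what the κ = −1
normal form PRESERVES — the fixed-point count on `U ⧸ K₀` and the exponent data (trace ∕ determinant ∕ discriminant) (architect A-p06 (g26) «=» 06:46:46Z), 2026-09-01.
-/
import Literature.NumberTheory.Automorphic.UnitaryThreeAnisotropicStabilizerCoordinates   -- ★ p841641 (A-p13 FILE 1): `r = −Aσq∕σs`, `|A| = |s| = 1` on `Stab(w₀)` (the (d1) normal form ★ `UnitaryThreeAnisotropicNormalForm` is the intended input; not imported)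
import HarnessLib

/-!
# The κ = −1 normal form, II: invariance of the fixed-point count and transfer of the exponents `(n, N, M)` to the `(A, q, r, s)` coordinates of `Stab(w₀)`
# (Flicker 1998, Prop. 5 p. 82, Lemma 14 p. 94, Prop. 16 p. 96, Thm. 18 p. 97)

Topic `NumberTheory/Automorphic`; namespace `Literature.NumberTheory.Automorphic.UnitaryGroup`.  THEOREMS ONLY (no `def`, no instance, no notation, no named fact,
no `sorry`; count-neutral).  Cell `pub/hodgecm-mathlib`, crux H413 = `stmt-HodgeConjecture-24833`, line «N7nsCount», value stub `stub_irredGValueNeg` (κ = −1).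
Sequel of ★ (d1) `exists_smul_one_inv_mul_conj_mem_stabilizer` (`t ↦ t′ = z⁻¹ (g⁻¹ t g) ∈ S`, `z = u·1 ∈ U ∩ K₀` central):
* §1 `natCard_fixedPoints_quotient_conj_eq`, `finite_fixedPoints_quotient_conj_iff` (conjugation permutes `U ⧸ K₀` by `y ↦ g • y`), `smul_quotient_eq_self_of_mem_unitaryInt_of_comm`,
  `setOf_fixedPoints_inv_mul_eq` (a central element of `K₀` acts trivially on `U ⧸ K₀`) ⇒ **`#Fix_{U⧸K₀}(t′) = #Fix_{U⧸K₀}(t)`**, finiteness alike;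
* §2 `trace_stabilizerShape`, `det_stabilizerShape` and **`model_trace_det_of_normalForm`**: if `tr t = T + u`, `det t = D·u` (i.e. `χ_t = (X² − TX + D)(X − u)`, the stub's
  `χ_{ι(γ_H)} = χ_g·(X − u)`) and `t′ = M(b_t,q_t,r_t,s_t)` (★ (C′) shape) then `A_t + s_t = T∕u` and `A_t s_t − 4ϖq_t r_t = D∕u²` (`A_t = 1 + 4ϖb_t`);
* §3 the valuations: **`v((A_t − s_t)² − 16ϖA_tσ(q_t)q_t∕σ(s_t)) = v(T² − 4D)`** (the input `hD` of ★ Bounds ED. 2 `v_q_eq_and_v_sub_le_of_v_disc` — so `ord disc = 2N+1` gives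
  `|q_t| = |ϖ|^N`, `|A_t − s_t| ≤ |ϖ|^{N+1}`), `v(A_t + s_t − 2) = v(T − 2u)` (the `M`-datum), `v(1 − (A_t+s_t) + (A_ts_t − 4ϖq_tr_t)) = v(u² − Tu + D)` (= `v(χ_g(u))`, the
  `n`-datum), and the dictionary to Prop. 16's `|A_t − 1|`: `v_sub_one_eq_of_lt` ∕ `v_sub_one_le_of_le` (`A + s − 2 = 2(A − 1) − (A − s)`, `|A − s| ≤ |ϖ|^{N+1}`, `|2| = 1`).
HONEST LABEL: HC_CM is proved only modulo the printed citations until rung 0 closes; structure theory feeding ONE value stub of #103-ns, pays nothing by itself.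

## References
* [Flicker1998UnitaryFL] Y. Z. Flicker, *Elementary proof of the fundamental lemma for a unitary group*, Canad. J. Math. 50 (1998), Prop. 5 p. 82, Lemma 14 p. 94,
  Prop. 16 p. 96, Thm. 18 p. 97.
* [Rogawski1990] J. D. Rogawski, *Automorphic Representations of Unitary Groups in Three Variables* (1990), §4.9 p. 55.
-/

set_option autoImplicit false

noncomputable section

open scoped MatrixGroups WithZero Valued
open Matrix

namespace Literature.NumberTheory.Automorphic

namespace UnitaryGroup

open Literature.NumberTheory.Automorphic.HermitianLattice

variable {K : Type*} [Field K] [Valued K ℤᵐ⁰] {ϖ : K}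
  (σ : K →+* K) {J : Matrix (Fin 3) (Fin 3) K} (hJ : J = (StdForm.antidiagonal 3).over K)

/-! ## §1 The fixed-point count on `U ⧸ K₀` is invariant under conjugation and under central `K₀`-translation -/

omit [Valued K ℤᵐ⁰] in
/-- Conjugation invariance, bijection form: `y ↦ g • y` maps the fixed points of `g⁻¹ t g` on `U ⧸ K₀` onto those of `t`. [cite: Flicker1998UnitaryFL, Prop. 5 p. 82] -/
theorem nonempty_fixedPoints_quotient_conj_equiv (K₀ : Subgroup ↥(unitaryGroupOfForm σ J)) (g t : ↥(unitaryGroupOfForm σ J)) :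
    Nonempty ({y : ↥(unitaryGroupOfForm σ J) ⧸ K₀ // (g⁻¹ * t * g) • y = y} ≃ {y : ↥(unitaryGroupOfForm σ J) ⧸ K₀ // t • y = y}) := by
  refine ⟨(MulAction.toPerm g).subtypeEquiv fun y => ?_⟩
  rw [MulAction.toPerm_apply, mul_smul, mul_smul, inv_smul_eq_iff]

omit [Valued K ℤᵐ⁰] in
/-- **`#Fix_{U⧸K₀}(g⁻¹ t g) = #Fix_{U⧸K₀}(t)`.** [cite: Flicker1998UnitaryFL, Prop. 5 p. 82] -/
theorem natCard_fixedPoints_quotient_conj_eq (K₀ : Subgroup ↥(unitaryGroupOfForm σ J)) (g t : ↥(unitaryGroupOfForm σ J)) :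
    Nat.card {y : ↥(unitaryGroupOfForm σ J) ⧸ K₀ | (g⁻¹ * t * g) • y = y} = Nat.card {y : ↥(unitaryGroupOfForm σ J) ⧸ K₀ | t • y = y} := by
  obtain ⟨e⟩ := nonempty_fixedPoints_quotient_conj_equiv σ K₀ g t
  exact Nat.card_congr e

omit [Valued K ℤᵐ⁰] in
/-- Finiteness of the fixed-point set is likewise conjugation invariant. [cite: Flicker1998UnitaryFL, Prop. 5 p. 82] -/
theorem finite_fixedPoints_quotient_conj_iff (K₀ : Subgroup ↥(unitaryGroupOfForm σ J)) (g t : ↥(unitaryGroupOfForm σ J)) :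
    {y : ↥(unitaryGroupOfForm σ J) ⧸ K₀ | (g⁻¹ * t * g) • y = y}.Finite ↔ {y : ↥(unitaryGroupOfForm σ J) ⧸ K₀ | t • y = y}.Finite := by
  obtain ⟨e⟩ := nonempty_fixedPoints_quotient_conj_equiv σ K₀ g t
  rw [← Set.finite_coe_iff, ← Set.finite_coe_iff]
  exact Equiv.finite_iff e

omit [Valued K ℤᵐ⁰] in
/-- A CENTRAL element of `K₀` acts trivially on `U ⧸ K₀`: `z • (aK₀) = zaK₀ = azK₀ = aK₀`. [cite: Flicker1998UnitaryFL, Prop. 16 p. 96 (central normalisation)] -/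
theorem smul_quotient_eq_self_of_mem_of_comm (K₀ : Subgroup ↥(unitaryGroupOfForm σ J)) {z : ↥(unitaryGroupOfForm σ J)} (hzK : z ∈ K₀)
    (hzc : ∀ y : ↥(unitaryGroupOfForm σ J), z * y = y * z) (y : ↥(unitaryGroupOfForm σ J) ⧸ K₀) : z • y = y := by
  induction y using QuotientGroup.induction_on with
  | H a =>
    rw [MulAction.Quotient.smul_coe, QuotientGroup.eq, smul_eq_mul, hzc a, _root_.mul_inv_rev, inv_mul_cancel_right]
    exact K₀.inv_mem hzK

omit [Valued K ℤᵐ⁰] in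
/-- **`Fix_{U⧸K₀}(z⁻¹ t) = Fix_{U⧸K₀}(t)`** for `z ∈ K₀` central. [cite: Flicker1998UnitaryFL, Prop. 16 p. 96] -/
theorem setOf_fixedPoints_inv_mul_eq (K₀ : Subgroup ↥(unitaryGroupOfForm σ J)) {z : ↥(unitaryGroupOfForm σ J)} (hzK : z ∈ K₀)
    (hzc : ∀ y : ↥(unitaryGroupOfForm σ J), z * y = y * z) (t : ↥(unitaryGroupOfForm σ J)) :
    {y : ↥(unitaryGroupOfForm σ J) ⧸ K₀ | (z⁻¹ * t) • y = y} = {y : ↥(unitaryGroupOfForm σ J) ⧸ K₀ | t • y = y} := by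
  have hzc' : ∀ y : ↥(unitaryGroupOfForm σ J), z⁻¹ * y = y * z⁻¹ := fun y =>
    calc z⁻¹ * y = z⁻¹ * (y * z) * z⁻¹ := by group
      _ = z⁻¹ * (z * y) * z⁻¹ := by rw [hzc y]
      _ = y * z⁻¹ := by group
  ext y
  rw [Set.mem_setOf_eq, Set.mem_setOf_eq, mul_smul, smul_quotient_eq_self_of_mem_of_comm σ K₀ (K₀.inv_mem hzK) hzc']

omit [Valued K ℤᵐ⁰] in
/-- **THE NORMAL FORM HAS THE SAME FIXED-POINT COUNT**: `#Fix_{U⧸K₀}(z⁻¹(g⁻¹tg)) = #Fix_{U⧸K₀}(t)` and `Fix(z⁻¹(g⁻¹tg))` finite iff `Fix(t)` finite (`z ∈ K₀` central).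
[cite: Flicker1998UnitaryFL, Prop. 5 p. 82; Prop. 16 p. 96] -/
theorem natCard_fixedPoints_quotient_normalForm_eq (K₀ : Subgroup ↥(unitaryGroupOfForm σ J)) {z : ↥(unitaryGroupOfForm σ J)} (hzK : z ∈ K₀)
    (hzc : ∀ y : ↥(unitaryGroupOfForm σ J), z * y = y * z) (g t : ↥(unitaryGroupOfForm σ J)) :
    Nat.card {y : ↥(unitaryGroupOfForm σ J) ⧸ K₀ | (z⁻¹ * (g⁻¹ * t * g)) • y = y} = Nat.card {y : ↥(unitaryGroupOfForm σ J) ⧸ K₀ | t • y = y} ∧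
      ({y : ↥(unitaryGroupOfForm σ J) ⧸ K₀ | (z⁻¹ * (g⁻¹ * t * g)) • y = y}.Finite ↔ {y : ↥(unitaryGroupOfForm σ J) ⧸ K₀ | t • y = y}.Finite) := by
  rw [setOf_fixedPoints_inv_mul_eq σ K₀ hzK hzc]
  exact ⟨natCard_fixedPoints_quotient_conj_eq σ K₀ g t, finite_fixedPoints_quotient_conj_iff σ K₀ g t⟩

/-! ## §2 Trace and determinant of the (C′) shape; the `2 × 2` model data of the normal form -/

omit [Valued K ℤᵐ⁰] in
/-- `tr M(b,q,r,s) = 1 + A + s`, `A = 1 + 4ϖb`. [cite: Flicker1998UnitaryFL, Prop. 4 p. 82] -/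
theorem trace_stabilizerShape (ϖ b q r s : K) :
    (!![1 + 2 * ϖ * b, q, b; 2 * ϖ * r, s, r; 4 * ϖ ^ 2 * b, 2 * ϖ * q, 1 + 2 * ϖ * b] : Matrix (Fin 3) (Fin 3) K).trace = 1 + (1 + 4 * ϖ * b) + s := by
  rw [Matrix.trace_fin_three]; simp; ring

omit [Valued K ℤᵐ⁰] in
/-- `det M(b,q,r,s) = A·s − 4ϖ·q·r` (= `det` of the `2 × 2` model; the eigenvalue on `w₀` is `1`). [cite: Flicker1998UnitaryFL, Prop. 4 p. 82; Prop. 16 p. 96] -/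
theorem det_stabilizerShape (ϖ b q r s : K) :
    (!![1 + 2 * ϖ * b, q, b; 2 * ϖ * r, s, r; 4 * ϖ ^ 2 * b, 2 * ϖ * q, 1 + 2 * ϖ * b] : Matrix (Fin 3) (Fin 3) K).det = (1 + 4 * ϖ * b) * s - 4 * ϖ * q * r := by
  rw [Matrix.det_fin_three]; simp; ring

omit [Valued K ℤᵐ⁰] in
/-- **THE `2 × 2` MODEL DATA OF THE NORMAL FORM.**  If `tr t = T + u` and `det t = D·u` (`χ_t = (X² − TX + D)(X − u)`), `z = u·1`, and the normal form `t′ = z⁻¹(g⁻¹tg)` has the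
(C′) shape `M(b_t, q_t, r_t, s_t)`, then `A_t + s_t = T∕u` and `A_t·s_t − 4ϖ·q_t·r_t = D∕u²` (trace and determinant are conjugation invariant; `g⁻¹tg = z·t′ = u·M`).
[cite: Flicker1998UnitaryFL, Prop. 16 p. 96; Thm. 18 p. 97] [cite: Rogawski1990, §4.9 p. 55] -/
theorem model_trace_det_of_normalForm {t g z : ↥(unitaryGroupOfForm σ J)} {u T D : K} (hu0 : u ≠ 0)
    (hz : ((z : GL (Fin 3) K) : Matrix (Fin 3) (Fin 3) K) = u • (1 : Matrix (Fin 3) (Fin 3) K))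
    (htr : ((t : GL (Fin 3) K) : Matrix (Fin 3) (Fin 3) K).trace = T + u) (hdet : ((t : GL (Fin 3) K) : Matrix (Fin 3) (Fin 3) K).det = D * u)
    {bt qt rt st : K}
    (ht' : (((z⁻¹ * (g⁻¹ * t * g) : ↥(unitaryGroupOfForm σ J)) : GL (Fin 3) K) : Matrix (Fin 3) (Fin 3) K) =
      !![1 + 2 * ϖ * bt, qt, bt; 2 * ϖ * rt, st, rt; 4 * ϖ ^ 2 * bt, 2 * ϖ * qt, 1 + 2 * ϖ * bt]) :
    (1 + 4 * ϖ * bt) + st = T / u ∧ (1 + 4 * ϖ * bt) * st - 4 * ϖ * qt * rt = D / u ^ 2 := by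
  -- `g⁻¹ t g = z · t′`, as matrices `u • M`
  have hconj : (((g⁻¹ * t * g : ↥(unitaryGroupOfForm σ J)) : GL (Fin 3) K) : Matrix (Fin 3) (Fin 3) K) =
      u • !![1 + 2 * ϖ * bt, qt, bt; 2 * ϖ * rt, st, rt; 4 * ϖ ^ 2 * bt, 2 * ϖ * qt, 1 + 2 * ϖ * bt] := by
    have h1 : g⁻¹ * t * g = z * (z⁻¹ * (g⁻¹ * t * g)) := by group
    rw [h1, Subgroup.coe_mul, Units.val_mul, ht', hz, Matrix.smul_mul, Matrix.one_mul]
  have hconj' : (((g⁻¹ * t * g : ↥(unitaryGroupOfForm σ J)) : GL (Fin 3) K) : Matrix (Fin 3) (Fin 3) K) =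
      (↑((g : GL (Fin 3) K)⁻¹) : Matrix (Fin 3) (Fin 3) K) * ((t : GL (Fin 3) K) : Matrix (Fin 3) (Fin 3) K) * ((g : GL (Fin 3) K) : Matrix (Fin 3) (Fin 3) K) := by
    rw [Subgroup.coe_mul, Subgroup.coe_mul, Subgroup.coe_inv, Units.val_mul, Units.val_mul]
  have htr' : (T + u) = u * (1 + (1 + 4 * ϖ * bt) + st) := by
    rw [← htr, ← Matrix.trace_units_conj' (g : GL (Fin 3) K), ← hconj', hconj, Matrix.trace_smul, trace_stabilizerShape, smul_eq_mul]
  have hdet' : D * u = u ^ 3 * ((1 + 4 * ϖ * bt) * st - 4 * ϖ * qt * rt) := by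
    rw [← hdet, ← Matrix.det_units_conj' (g : GL (Fin 3) K), ← hconj', hconj, Matrix.det_smul, det_stabilizerShape, Fintype.card_fin]
  constructor
  · rw [eq_div_iff hu0]; linear_combination -htr'
  · rw [eq_div_iff (pow_ne_zero 2 hu0)]
    apply mul_left_cancel₀ hu0
    linear_combination -hdet'

/-! ## §3 The valuations: discriminant, `tr − 2`, `χ(1)`, and the dictionary to `|A_t − 1|` -/

include hJ in
/-- **EXPONENT TRANSFER.**  For `t′ ∈ Stab(w₀)` with (C′) coordinates satisfying `A + s = T∕u`, `As − 4ϖqr = D∕u²` (§2) and `σu·u = 1`: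
`v((A − s)² − 16ϖAσ(q)q∕σ(s)) = v(T² − 4D)` (so ★ `v_q_eq_and_v_sub_le_of_v_disc` applies with the stub's `ord(tr² − 4det) = 2N+1`), `v(A + s − 2) = v(T − 2u)` (the `M`-datum) and
`v(1 − (A + s) + (As − 4ϖqr)) = v(u² − Tu + D)` (the `n`-datum `ord χ_g(u)`). [cite: Flicker1998UnitaryFL, Lemma 14 p. 94; Thm. 18 p. 97] -/
theorem v_model_invariants_eq (hd : LocalConjDatum σ ϖ) {h : ↥(unitaryGroupOfForm σ J)} {b q r s : K}
    (hh : ((h : GL (Fin 3) K) : Matrix (Fin 3) (Fin 3) K) = !![1 + 2 * ϖ * b, q, b; 2 * ϖ * r, s, r; 4 * ϖ ^ 2 * b, 2 * ϖ * q, 1 + 2 * ϖ * b])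
    {u T D : K} (hu : σ u * u = 1) (htr : (1 + 4 * ϖ * b) + s = T / u) (hdet : (1 + 4 * ϖ * b) * s - 4 * ϖ * q * r = D / u ^ 2) :
    Valued.v (((1 + 4 * ϖ * b) - s) ^ 2 - 16 * ϖ * (1 + 4 * ϖ * b) * (σ q * q) / σ s) = Valued.v (T ^ 2 - 4 * D) ∧
      Valued.v ((1 + 4 * ϖ * b) + s - 2) = Valued.v (T - 2 * u) ∧
      Valued.v (1 - ((1 + 4 * ϖ * b) + s) + ((1 + 4 * ϖ * b) * s - 4 * ϖ * q * r)) = Valued.v (u ^ 2 - T * u + D) := by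
  have hu0 : u ≠ 0 := fun h0 => by rw [h0, mul_zero] at hu; exact zero_ne_one hu
  have hvu : Valued.v u = 1 := by
    have h1 := congrArg Valued.v hu
    rw [map_mul, hd.vσ, map_one, ← pow_two] at h1
    exact (pow_eq_one_iff.1 h1).resolve_right (by norm_num)
  obtain ⟨hs1, -, -, -⟩ := stabilizer_valuation_bounds σ hJ hd hh
  have hσs0 : σ s ≠ 0 := fun h0 => by
    have h1 : Valued.v (σ s) = 1 := by rw [hd.vσ, hs1]
    rw [h0, map_zero] at h1; exact zero_ne_one h1
  have hr := stabilizer_r_eq σ hJ hd hh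
  -- the discriminant: `(A − s)² − 16ϖAσq q∕σs = (A + s)² − 4(As − 4ϖqr) = (T² − 4D)∕u²`
  have hdisc : ((1 + 4 * ϖ * b) - s) ^ 2 - 16 * ϖ * (1 + 4 * ϖ * b) * (σ q * q) / σ s = (T ^ 2 - 4 * D) / u ^ 2 := by
    have h16 : 16 * ϖ * (1 + 4 * ϖ * b) * (σ q * q) / σ s = -(16 * ϖ * q * r) := by
      rw [hr]; field_simp
    rw [h16, show ((1 + 4 * ϖ * b) - s) ^ 2 - -(16 * ϖ * q * r) = ((1 + 4 * ϖ * b) + s) ^ 2 - 4 * ((1 + 4 * ϖ * b) * s - 4 * ϖ * q * r) by ring,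
      htr, hdet]
    field_simp
  refine ⟨?_, ?_, ?_⟩
  · rw [hdisc, map_div₀, map_pow, hvu, one_pow, div_one]
  · rw [htr, show T / u - 2 = (T - 2 * u) / u by field_simp, map_div₀, hvu, div_one]
  · rw [htr, hdet, show 1 - T / u + D / u ^ 2 = (u ^ 2 - T * u + D) / u ^ 2 by field_simp, map_div₀, map_pow, hvu, one_pow, div_one]

/-- Dictionary, case `M ≤ N`: if `|ϖ|^{N+1} < |A + s − 2|` and `|A − s| ≤ |ϖ|^{N+1}` then `|A − 1| = |A + s − 2|` (`2(A − 1) = (A + s − 2) + (A − s)`, `|2| = 1`).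
[cite: Flicker1998UnitaryFL, Thm. 18 p. 97 (`n = min(1+2N, 2+2N₂)`)] -/
theorem v_sub_one_eq_of_lt (hd : LocalConjDatum σ ϖ) {A s : K} {N : ℕ} (hAs : Valued.v (A - s) ≤ WithZero.exp (-((N : ℤ) + 1)))
    (hM : WithZero.exp (-((N : ℤ) + 1)) < Valued.v (A + s - 2)) : Valued.v (A - 1) = Valued.v (A + s - 2) := by
  have h2 : Valued.v (2 : K) = 1 := hd.v2
  have hkey : (2 : K) * (A - 1) = (A + s - 2) + (A - s) := by ring
  have h := Valuation.map_add_eq_of_lt_left Valued.v (lt_of_le_of_lt hAs hM)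
  rw [← hkey, map_mul, h2, one_mul] at h
  exact h

/-- Dictionary, case `N < M`: if `|A + s − 2| ≤ |ϖ|^{N+1}` and `|A − s| ≤ |ϖ|^{N+1}` then `|A − 1| ≤ |ϖ|^{N+1}`. [cite: Flicker1998UnitaryFL, Thm. 18 p. 97] -/
theorem v_sub_one_le_of_le (hd : LocalConjDatum σ ϖ) {A s : K} {N : ℕ} (hAs : Valued.v (A - s) ≤ WithZero.exp (-((N : ℤ) + 1)))
    (hM : Valued.v (A + s - 2) ≤ WithZero.exp (-((N : ℤ) + 1))) : Valued.v (A - 1) ≤ WithZero.exp (-((N : ℤ) + 1)) := by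
  have h2 : Valued.v (2 : K) = 1 := hd.v2
  have hkey : (2 : K) * (A - 1) = (A + s - 2) + (A - s) := by ring
  have h := Valuation.map_add_le Valued.v hM hAs
  rw [← hkey, map_mul, h2, one_mul] at h
  exact h

end UnitaryGroup

end Literature.NumberTheory.Automorphic

end
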